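import Summits.QuantumFields.BalabanUV.Beta.EriceRemainderEnclosureHistoryAutonomyComparisonAgeCompositionStaticChainWindowMass

/-!
# EriceRemainderEnclosureHistoryAutonomyComparisonAgeCompositionStaticChainLevelCoupled — (E76c) THE WINDOW-MASS STEP OVER THE LEVEL-COUPLED BUDGET (route
# (N′), skeleton): with the young's AMPLIFIED budget `x(s + A) + U ≤ ½` ((E76b) `young_budget_amplified`: `A = 2Σ_{k>y} x_kσ_kΔ_k` the young's own amplification
# of the older charges) the KEY ratio obeys `ρ ≤ (½ − U)(1+V)∕((s + A)(1 − Ω))` (no sign needed on `x`); it is below the LONE cap `1∕(2s)` as soon as the older configuration's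
# «balance» `(1 − 2U)(1 + V) ≤ (1 + A∕s)(1 − Ω)` holds, and below `q` as soon as `(1 − 2U)(1+V) ≤ 2q(s+A)(1−Ω)`; and the FIRST-ORDER FAR-AGE BALANCE: an older age
# whose carried ratio is at most `B·x` with `θB + 1∕r ≤ 2σ(1 + Δ∕s)` adds no more to `V + Ω` than to `2U + A∕s`

Cell `pub-balaban`, β-function sub-cell, BINDER row D4 «RemainderConst leaves for Bałaban's split» (`HOME/BINDER-OWNERS.md`; owner lineage `b2b-balaban-beta-an4`;
this file by co-owner #2 lineage `b2b-balaban-beta-d4-p2`, generation 67), β-FLOW TEAM duty (1), FREEZE (0) honoured (def-free; imports (E74a) `…StaticChainWindowMass`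
(for the tree position only; nothing restated).

HONEST FRAMING (page 1, verbatim and binding).  *"Discharging BetaPertH makes Bałaban's UV stability UNCONDITIONAL — a real constructive-QFT result; it is
NOT the continuum limit and NOT the Clay problem."*  THIS FILE DISCHARGES NOTHING OF THE KIND.  Elementary algebra of real inequalities — hypotheses of a
census, not facts; the form, signs, ages and moments of Bałaban's (1.22) limit functional are NOT PRINTED ([I] p. 298; GAPS G-t4-U2-1∕-2) and NOT asserted.  Row D4
class UNCHANGED (critical-path width 0; instance 0∕1; D4 DISCHARGE NO DATE).  HONEST DEPENDENCY: continuum YM on T⁴ ⇐ BetaPertH ∧ nine spine estimates (0/9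
proved); BetaPertH ⇐ (D1) ∧ (D4) ∧ CAP+tail; G-an2-4 gates asym, D1 and NE2/3/4.

THE POINT (README `HOME/b2b-balaban-beta-d4-p2/g67/e76/README.md` §5–§6).  Over (E65a)'s polytope the window-mass step is `ρ ≤ 1∕(2s) + x·V` ((E74a)) and the
interaction term `x·V` reaches 0.15–0.22; over the LEVEL-COUPLED system of (E76b) the young's own reads amplify every older charge (`A > 0`) and, numerically,
no older age at ratio `≥ 1.1` ever pays (`ρ_y ≤` lone cap; README §5 tables).  This file fixes the algebraic shape of that step and of the per-age balance a
proof of route (N′) will sum (README §6: far ages over-pay ×2–×6; the near window is the block fluid's).  Letters: `s = S_{y,y}∕y`, `U = Σ_{k>y} x_kS_{k,y}∕k`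
(plain older usage), `A` (amplification weight sum), `V` (chain load), `Ω` (window mass), all functions of the OLDER configuration; `x` the young's load.
NOT CLAIMED: the balance itself for any configuration; the static closure; anything printed.

WHAT IS PROVED ([folklore]; 0 `def`, 0 sorry).  §1 `cap_le_of_amplified_budget`, **`key_ratio_le_amplified`**.  §2 **`key_ratio_le_lone_of_balance`**,
`key_ratio_le_of_balance`.  §3 **`far_age_balance_first_order`**, `sum_balance_first_order` (summed over the older ages: `V + Ω ≤ 2U + A∕s`).
-/
noncomputable section
open Finset

namespace Summit.QuantumFields.BalabanUV.Beta.EriceRemainderEnclosureHistoryAutonomyComparisonAgeCompositionStaticChainLevelCoupled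

/-! ## §1 The step with the amplified budget -/

/-- The young's cap from the amplified budget: `x(s + A) + U ≤ ½`, `s + A > 0` ⟹ `x ≤ (½ − U)∕(s + A)`. [folklore] -/
theorem cap_le_of_amplified_budget {x s A U : ℝ} (hsA : 0 < s + A) (hbud : x * (s + A) + U ≤ 1 / 2) : x ≤ (1 / 2 - U) / (s + A) := by
  rw [le_div_iff₀ hsA]; linarith

/-- **THE WINDOW-MASS STEP OVER THE AMPLIFIED BUDGET**: `ρ = x(1+V)∕(1−Ω) ≤ (½ − U)(1+V)∕((s+A)(1−Ω))` for `V ≥ 0`, `Ω < 1`, `s + A > 0` and the budget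
`x(s + A) + U ≤ ½` ((E76b) `young_budget_amplified` divided by two). [folklore] -/
theorem key_ratio_le_amplified {x s A U V Ω : ℝ} (hV : 0 ≤ V) (hΩ : Ω < 1) (hsA : 0 < s + A) (hbud : x * (s + A) + U ≤ 1 / 2) :
    x * (1 + V) / (1 - Ω) ≤ (1 / 2 - U) * (1 + V) / ((s + A) * (1 - Ω)) := by
  have hcap := cap_le_of_amplified_budget hsA hbud
  have h1Ω : 0 < 1 - Ω := sub_pos.mpr hΩ
  rw [div_le_div_iff₀ h1Ω (mul_pos hsA h1Ω)]
  have h2 : x * (s + A) ≤ 1 / 2 - U := by rw [le_div_iff₀ hsA] at hcap; exact hcap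
  have h3 : 0 ≤ (1 + V) * (1 - Ω) := mul_nonneg (by linarith) h1Ω.le
  nlinarith [mul_le_mul_of_nonneg_right h2 h3]

/-! ## §2 The balance conditions -/

/-- **BELOW THE LONE CAP UNDER BALANCE.**  If the older configuration is balanced against the young's amplified budget,
`(1 − 2U)(1 + V) ≤ (1 + A∕s)(1 − Ω)`, then `ρ ≤ 1∕(2s)` — the young's lone normal-form cap ((E74a): `1∕(2s) = y∕(2S_{y,y})`).  «Interaction does not pay.»
[folklore] -/
theorem key_ratio_le_lone_of_balance {x s A U V Ω : ℝ} (hV : 0 ≤ V) (hΩ : Ω < 1) (hs : 0 < s) (hA : 0 ≤ A)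
    (hbud : x * (s + A) + U ≤ 1 / 2) (hbal : (1 - 2 * U) * (1 + V) ≤ (1 + A / s) * (1 - Ω)) :
    x * (1 + V) / (1 - Ω) ≤ 1 / (2 * s) := by
  have hsA : 0 < s + A := by linarith
  have h1Ω : 0 < 1 - Ω := sub_pos.mpr hΩ
  refine (key_ratio_le_amplified hV hΩ hsA hbud).trans ?_
  rw [div_le_div_iff₀ (mul_pos hsA h1Ω) (by linarith)]
  have e : (1 + A / s) * (1 - Ω) * (2 * s) = 2 * ((s + A) * (1 - Ω)) := by field_simp
  have hbal' := mul_le_mul_of_nonneg_right hbal (by linarith : (0 : ℝ) ≤ 2 * s)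
  rw [e] at hbal'
  nlinarith [hbal']

/-- Below `q` under the `q`-balance `(1 − 2U)(1+V) ≤ 2q(s+A)(1−Ω)`. [folklore] -/
theorem key_ratio_le_of_balance {x s A U V Ω q : ℝ} (hV : 0 ≤ V) (hΩ : Ω < 1) (hsA : 0 < s + A)
    (hbud : x * (s + A) + U ≤ 1 / 2) (hbal : (1 - 2 * U) * (1 + V) ≤ 2 * q * ((s + A) * (1 - Ω))) :
    x * (1 + V) / (1 - Ω) ≤ q := by
  have h1Ω : 0 < 1 - Ω := sub_pos.mpr hΩ
  refine (key_ratio_le_amplified hV hΩ hsA hbud).trans ?_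
  rw [div_le_iff₀ (mul_pos hsA h1Ω)]
  nlinarith [hbal]

/-! ## §3 The first-order far-age balance -/

/-- **FIRST-ORDER FAR-AGE BALANCE.**  An older age at ratio `r` with load `x ≥ 0`, defect `θ`, charge `σ` on the young's line, amplification weight `Δ`, and
carried ratio `β ≤ B·x`; if `θB + 1∕r ≤ 2σ(1 + Δ∕s)` then its contributions balance: `θβ + x∕r ≤ 2xσ + 2xσΔ∕s` (what it adds to `V + Ω` is at most what it
adds to `2U + A∕s`).  README §5: `B(2) ≈ 1.9`, `B(4) ≈ 3.1`, `B(8) ≈ 4.9` with the tree's `θ̄`, continuum `σ, Δ`. [folklore] -/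
theorem far_age_balance_first_order {θ σ Δ r s B x β : ℝ} (hθ : 0 ≤ θ) (hx : 0 ≤ x) (hβ : β ≤ B * x)
    (hB : θ * B + 1 / r ≤ 2 * σ * (1 + Δ / s)) :
    θ * β + x / r ≤ 2 * x * σ + 2 * x * σ * Δ / s := by
  have h1 : θ * β ≤ θ * (B * x) := mul_le_mul_of_nonneg_left hβ hθ
  have h2 := mul_le_mul_of_nonneg_left hB hx
  have e1 : x * (θ * B + 1 / r) = θ * (B * x) + x / r := by ring
  have e2 : x * (2 * σ * (1 + Δ / s)) = 2 * x * σ + 2 * x * σ * Δ / s := by ring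
  rw [e1, e2] at h2
  linarith

/-- Summing the far-age balances over the older ages `i < n`: `Σθ_iβ_i + Σx_i∕r_i ≤ 2Σx_iσ_i + (2Σx_iσ_iΔ_i)∕s`, i.e. `V + Ω ≤ 2U + A∕s` in README §6's letters
(first order; the products `UV`, `ΩA∕s` of the exact balance of §2 are the next order). [folklore] -/
theorem sum_balance_first_order {n : ℕ} {θ σ Δ r B x β : ℕ → ℝ} {s : ℝ} (hθ : ∀ i, i < n → 0 ≤ θ i) (hx : ∀ i, i < n → 0 ≤ x i)
    (hβ : ∀ i, i < n → β i ≤ B i * x i) (hB : ∀ i, i < n → θ i * B i + 1 / r i ≤ 2 * σ i * (1 + Δ i / s)) :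
    ∑ i ∈ range n, θ i * β i + ∑ i ∈ range n, x i / r i ≤
      2 * ∑ i ∈ range n, x i * σ i + (2 * ∑ i ∈ range n, x i * σ i * Δ i) / s := by
  have h : ∀ i ∈ range n, θ i * β i + x i / r i ≤ 2 * x i * σ i + 2 * x i * σ i * Δ i / s := fun i hi =>
    far_age_balance_first_order (hθ i (mem_range.mp hi)) (hx i (mem_range.mp hi)) (hβ i (mem_range.mp hi)) (hB i (mem_range.mp hi))
  have hs := sum_le_sum h
  rw [sum_add_distrib, sum_add_distrib] at hs
  have e1 : ∑ i ∈ range n, 2 * x i * σ i = 2 * ∑ i ∈ range n, x i * σ i := by rw [mul_sum]; exact sum_congr rfl fun i _ => by ring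
  have e2 : ∑ i ∈ range n, 2 * x i * σ i * Δ i / s = (2 * ∑ i ∈ range n, x i * σ i * Δ i) / s := by
    rw [mul_sum, sum_div]; exact sum_congr rfl fun i _ => by ring
  rw [e1, e2] at hs
  exact hs

end Summit.QuantumFields.BalabanUV.Beta.EriceRemainderEnclosureHistoryAutonomyComparisonAgeCompositionStaticChainLevelCoupled

end
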